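import Literature.Barriers.NavierStokesRegularity.NavierStokesInequalitySwirlLaplacian
import Literature.Analysis.FluidPDE.PressurePoisson
import Literature.Analysis.FluidPDE.PressureRepresentation
import HarnessLib

/-!
# The pressure sources of `u[v,f]` and `u[v,g]` differ by `-r⁻¹∂ᵣ(f² - g²)` (Ożański, App. A.3)

Barrier catalogue support file for `NavierStokesRegularity` (D-0021), on the discharge path of
fact D-II `Literature.Barriers.NavierStokesRegularity.NSIProfiles_of_arrangement`
(`NavierStokesInequalityProfiles`; Ożański, arXiv:1709.00602v4, §4.1–4.2): the inequality (4.27)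
of §4.2, Case 2, needs `∇p[aⱼᵏ(t)vⱼ, qᵏⱼ,ₜ] - ∇p[aⱼᵏ(t)vⱼ, hⱼ,ₜ] → 0` uniformly, which is the
first lemma of Appendix A.3 ("Some continuity properties of `p[v,f]` and `u[v,f]` with respect
to `f`"; held plain-text rendering: §8.3, Lemma 23): "`∇p[v_k,f_k] - ∇p[v_k,f] → 0` uniformly
… The point of the lemma is that we do not require any convergence of the `v_k`'s." Its proof
rests on ONE structural identity: for `u = u[v,f]` the source `Σ∂ᵢuⱼ∂ⱼuᵢ` on the meridian
plane is `(∂₁v₁)² + (∂₂v₂)² + 2∂₂v₁∂₁v₂ - ∂₂(f² - |v|²)/(2x₂) + v₂²/x₂²`, whence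
"`F_k(y) - G_k(y) = (∂₂f² - ∂₂f_k²)/2z₂`, as all the terms that include the components of
`v_k`'s vanish". This file PROVES that identity of differences for the tree's objects
(`pressureSource u = ∂ᵢ∂ⱼ(uᵢuⱼ) = div((u·∇)u + (div u)u)`, `swirlField v f = u[v,f]`):

* `IsNSIStructure.pressureSource_swirlField_sub` — for two structures `(v,f,φ)`, `(v,g,ψ)` on
  the same `U`, **`G[u[v,f]](x) - G[u[v,g]](x) = -r⁻¹ ∂ᵣ(f² - g²)(R⁻¹x)`** for every `x ∈ ℝ³`
  (the analytic half — the resulting bound on `∇p̃[u[v,f]] - ∇p̃[u[v,g]]` — is the tree's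
  `NormalisedPressurePerturbation`).

The computation is organised through *frame fields* `Φ(y) = a(q) hy + b(q) x̂_axis + c(q) Jy`
(`q = R⁻¹y`, `hy = (y₀,y₁,0) = r ρ̂`, `Jy = (-y₁,y₀,0) = r φ̂`; `u[v,f]` is the frame field with
`a = v_r/r`, `b = v_z`, `c = √(f² - |v|²)/r`, `swirlField_eq_linear`):

* `convect_frame` — `(Φ·∇)Φ = (Ta + a² - c²) h + (Tc + 2ac) J + (Tb) x̂_axis`,
  `Te = a r∂ᵣe + b∂_z e` (the swirl direction does not differentiate axisymmetric profiles,
  `fderiv_comp_meridian_frame`; `h(Φ) = a h + c J`, `J(Φ) = a J - c h`);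
* `divergence_frame` — `div Φ = 2a + r∂ᵣa + ∂_z b` (cf. Lemma 3.1 (i), `divergence_swirlField`);
* `sourceField_frame` — `W[Φ] := (Φ·∇)Φ + (div Φ)Φ = P h + M J + Q x̂_axis`;
* `pressureSource_frame_sub` — for `c₁, c₂` on the same `a, b` (smooth, vanishing near the
  axis): `W₁ - W₂ = -(c₁² - c₂²) h + Λ J` near `x`, and `div(Λ J) = 0`, `div(κ h) = 2κ + r∂ᵣκ`,
  so `G[Φ₁] - G[Φ₂] = -(2κ + r∂ᵣκ)`, `κ = c₁² - c₂²`; for swirl fields `κ = (f² - g²)/r²` and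
  `-(2κ + r∂ᵣκ) = -∂ᵣ(f² - g²)/r`.

Sign/factor check against the print: from the table (3.27) the only `f`-dependent products in
`Σ∂ᵢuⱼ∂ⱼuᵢ` are `2∂₂u₃∂₃u₂ = -2s∂_ρs/ρ = -∂_ρ(s²)/ρ`, `s² = f² - |v|²`, i.e. the factor is `1/x₂`
(printed `1/(2x₂)`); the factor is immaterial for the convergence statement the identity serves.

## Mathlib search

`HasFDerivAt.smul`, `HasFDerivAt.add`, `fderiv_fun_mul`, `hasFDerivAt_inv`,
`Filter.EventuallyEq.fderiv_eq`, `isOpen_ne_fun` (used); tree: `divergence_comp_meridian_smul`,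
`fderiv_comp_meridian_horizontal/rotGen/eZ`, `divergence_horizontal`, `divergence_rotGen`,
`swirlField_eq_linear`, `contDiff_mul_inv_fst_of_eq_zero` (`NavierStokesInequalitySwirlCalculus`),
`divergence_add_apply`, `divergence_sub_apply` (`PressurePoisson`), `pressureSource_def`,
`contDiff_convect_self` (`PressureRepresentation`).

## References

* W. S. Ożański, *On weak solutions to the Navier–Stokes inequality with internal
  singularities*, arXiv:1709.00602v4, Appendix A.3, first lemma and its proof (held rendering:
  §8.3, Lemma 23), with §3.3 (3.26)–(3.27) and Lemma 3.1. [`Ozanski2017NSISingular`]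
* V. Scheffer, *A solution to the Navier–Stokes inequality with an internal singularity*,
  Comm. Math. Phys. 101 (1985), Lemma 3.2 ((3.42)–(3.55): the corresponding uniform-continuity
  step). [`Scheffer1985`]
-/

noncomputable section

open MeasureTheory Set Function Filter Topology TopologicalSpace WithLp Metric
open scoped ENNReal InnerProductSpace RealInnerProductSpace ContDiff

namespace Literature.Barriers.NavierStokesRegularity

open Literature.Analysis.FluidPDE

/-! ### Algebra of the linear frame fields `(x₀,x₁,0)`, `Jx`, `x̂_axis` -/

/-- `h(hx) = hx` for the horizontal projection `h(x) = (x₀,x₁,0)`. [folklore] -/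
theorem horizontal_horizontal (y : EuclideanSpace ℝ (Fin 3)) :
    (toLp 2 ![(toLp 2 ![y 0, y 1, 0] : EuclideanSpace ℝ (Fin 3)) 0,
        (toLp 2 ![y 0, y 1, 0] : EuclideanSpace ℝ (Fin 3)) 1, 0] : EuclideanSpace ℝ (Fin 3)) =
      toLp 2 ![y 0, y 1, 0] := by
  ext i; fin_cases i <;> simp

/-- The horizontal projection of a frame combination: `h(a hx + b x̂_axis + c Jx) = a hx + c Jx`.
[folklore] -/
theorem horizontal_frame (a b c : ℝ) (x : EuclideanSpace ℝ (Fin 3)) :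
    (toLp 2 ![(a • (toLp 2 ![x 0, x 1, 0] : EuclideanSpace ℝ (Fin 3)) + b • eZ + c • rotGen x) 0,
        (a • (toLp 2 ![x 0, x 1, 0] : EuclideanSpace ℝ (Fin 3)) + b • eZ + c • rotGen x) 1, 0] :
        EuclideanSpace ℝ (Fin 3)) =
      a • (toLp 2 ![x 0, x 1, 0] : EuclideanSpace ℝ (Fin 3)) + c • rotGen x := by
  ext i; fin_cases i <;> simp [rotGen, eZ]

/-- The rotation generator on a frame combination: `J(a hx + b x̂_axis + c Jx) = a Jx - c hx`
(`J(hx) = Jx`, `J x̂_axis = 0`, `J(Jx) = -hx`). [folklore] -/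
theorem rotGen_frame (a b c : ℝ) (x : EuclideanSpace ℝ (Fin 3)) :
    rotGen (a • (toLp 2 ![x 0, x 1, 0] : EuclideanSpace ℝ (Fin 3)) + b • eZ + c • rotGen x) =
      a • rotGen x - c • (toLp 2 ![x 0, x 1, 0] : EuclideanSpace ℝ (Fin 3)) := by
  ext i; fin_cases i <;> simp [rotGen, eZ] <;> ring

/-- `⟪ρ̂, a hx + b x̂_axis + c Jx⟫ = a r` off the axis... in fact everywhere: `⟪ρ̂, hx⟫ = r`,
`⟪ρ̂, x̂_axis⟫ = ⟪ρ̂, Jx⟫ = 0`. [folklore] -/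
theorem inner_eR_frame (a b c : ℝ) (x : EuclideanSpace ℝ (Fin 3)) :
    ⟪eR x, a • (toLp 2 ![x 0, x 1, 0] : EuclideanSpace ℝ (Fin 3)) + b • eZ + c • rotGen x⟫ =
      a * cylRadius x := by
  simp only [inner_add_right, inner_smul_right, inner_eR_horizontal, inner_eR_eZ, inner_eR_rotGen,
    mul_zero, add_zero]

/-- The axial component of `a hx + b x̂_axis + c Jx` is `b`. [folklore] -/
theorem frame_apply_two (a b c : ℝ) (x : EuclideanSpace ℝ (Fin 3)) :
    (a • (toLp 2 ![x 0, x 1, 0] : EuclideanSpace ℝ (Fin 3)) + b • eZ + c • rotGen x) 2 = b := by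
  simp [rotGen, eZ]

/-! ### Derivatives of lifted profiles along frame fields -/

/-- **A lifted planar profile differentiated along a frame field**:
`D(e∘meridian)(x)(a hx + b x̂_axis + c Jx) = a r ∂ᵣe + b ∂_z e` (the swirl direction `Jx` does
not see axisymmetric scalars). [folklore] -/
theorem fderiv_comp_meridian_frame {e : ℝ × ℝ → ℝ} (a b c : ℝ) {x : EuclideanSpace ℝ (Fin 3)}
    (hx : cylRadius x ≠ 0) (he : DifferentiableAt ℝ e (meridian x)) :
    fderiv ℝ (fun y => e (meridian y)) x
        (a • (toLp 2 ![x 0, x 1, 0] : EuclideanSpace ℝ (Fin 3)) + b • eZ + c • rotGen x) =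
      a * (cylRadius x * derivR e (meridian x)) + b * derivZ e (meridian x) := by
  simp only [map_add, map_smul, smul_eq_mul, fderiv_comp_meridian_horizontal hx he,
    fderiv_comp_meridian_eZ hx he, fderiv_comp_meridian_rotGen hx he, mul_zero, add_zero]

/-! ### The convective term of a frame field -/

section Frame

variable {a b c : ℝ × ℝ → ℝ} {x : EuclideanSpace ℝ (Fin 3)}

/-- The horizontal projection as a function is differentiable, with derivative itself.
[folklore] -/
theorem hasFDerivAt_horizontal (x : EuclideanSpace ℝ (Fin 3)) :
    HasFDerivAt (fun y : EuclideanSpace ℝ (Fin 3) => (toLp 2 ![y 0, y 1, 0] : EuclideanSpace ℝ (Fin 3)))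
      (ContinuousLinearMap.id ℝ (EuclideanSpace ℝ (Fin 3)) -
        (EuclideanSpace.proj (2 : Fin 3) : EuclideanSpace ℝ (Fin 3) →L[ℝ] ℝ).smulRight eZ) x := by
  rw [show (fun y : EuclideanSpace ℝ (Fin 3) => (toLp 2 ![y 0, y 1, 0] : EuclideanSpace ℝ (Fin 3))) =
      ⇑(ContinuousLinearMap.id ℝ (EuclideanSpace ℝ (Fin 3)) -
        (EuclideanSpace.proj (2 : Fin 3) : EuclideanSpace ℝ (Fin 3) →L[ℝ] ℝ).smulRight eZ)
    from funext horizontal_eq_clm]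
  exact ContinuousLinearMap.hasFDerivAt _

/-- **The convective derivative of a frame field along itself**, off the axis: for
`Φ(y) = a(q) hy + b(q) x̂_axis + c(q) Jy` (`q = meridian y`),
`(Φ·∇)Φ(x) = (Ta + a² - c²) hx + (Tc + 2ac) Jx + (Tb) x̂_axis`, where `Te = a r ∂ᵣe + b ∂_z e`
(values at `q = meridian x`, `r = cylRadius x`). [folklore] -/
theorem convect_frame (hx : cylRadius x ≠ 0) (ha : DifferentiableAt ℝ a (meridian x))
    (hb : DifferentiableAt ℝ b (meridian x)) (hc : DifferentiableAt ℝ c (meridian x)) :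
    convect (fun y : EuclideanSpace ℝ (Fin 3) => a (meridian y) •
        (toLp 2 ![y 0, y 1, 0] : EuclideanSpace ℝ (Fin 3)) + b (meridian y) • eZ +
        c (meridian y) • rotGen y)
      (fun y : EuclideanSpace ℝ (Fin 3) => a (meridian y) •
        (toLp 2 ![y 0, y 1, 0] : EuclideanSpace ℝ (Fin 3)) + b (meridian y) • eZ +
        c (meridian y) • rotGen y) x =
      (a (meridian x) * (cylRadius x * derivR a (meridian x)) + b (meridian x) * derivZ a (meridian x) +
          a (meridian x) ^ 2 - c (meridian x) ^ 2) •
        (toLp 2 ![x 0, x 1, 0] : EuclideanSpace ℝ (Fin 3)) +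
      (a (meridian x) * (cylRadius x * derivR c (meridian x)) + b (meridian x) * derivZ c (meridian x) +
          2 * a (meridian x) * c (meridian x)) • rotGen x +
      (a (meridian x) * (cylRadius x * derivR b (meridian x)) + b (meridian x) * derivZ b (meridian x)) •
        eZ := by
  set q := meridian x with hq
  have hA : HasFDerivAt (fun y : EuclideanSpace ℝ (Fin 3) => a (meridian y))
      (fderiv ℝ (fun y : EuclideanSpace ℝ (Fin 3) => a (meridian y)) x) x :=
    (differentiableAt_comp_meridian hx ha).hasFDerivAt
  have hB : HasFDerivAt (fun y : EuclideanSpace ℝ (Fin 3) => b (meridian y))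
      (fderiv ℝ (fun y : EuclideanSpace ℝ (Fin 3) => b (meridian y)) x) x :=
    (differentiableAt_comp_meridian hx hb).hasFDerivAt
  have hC : HasFDerivAt (fun y : EuclideanSpace ℝ (Fin 3) => c (meridian y))
      (fderiv ℝ (fun y : EuclideanSpace ℝ (Fin 3) => c (meridian y)) x) x :=
    (differentiableAt_comp_meridian hx hc).hasFDerivAt
  have hΦ := ((hA.smul (hasFDerivAt_horizontal x)).add
    (hB.smul (hasFDerivAt_const (eZ : EuclideanSpace ℝ (Fin 3)) x))).add
    (hC.smul (hasFDerivAt_rotGen x))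
  -- the vector along which we differentiate
  set w : EuclideanSpace ℝ (Fin 3) := a q • (toLp 2 ![x 0, x 1, 0] : EuclideanSpace ℝ (Fin 3)) +
    b q • eZ + c q • rotGen x with hw
  have hTa : fderiv ℝ (fun y => a (meridian y)) x w =
      a q * (cylRadius x * derivR a q) + b q * derivZ a q := fderiv_comp_meridian_frame _ _ _ hx ha
  have hTb : fderiv ℝ (fun y => b (meridian y)) x w =
      a q * (cylRadius x * derivR b q) + b q * derivZ b q := fderiv_comp_meridian_frame _ _ _ hx hb
  have hTc : fderiv ℝ (fun y => c (meridian y)) x w =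
      a q * (cylRadius x * derivR c q) + b q * derivZ c q := fderiv_comp_meridian_frame _ _ _ hx hc
  have hDH : (ContinuousLinearMap.id ℝ (EuclideanSpace ℝ (Fin 3)) -
        (EuclideanSpace.proj (2 : Fin 3) : EuclideanSpace ℝ (Fin 3) →L[ℝ] ℝ).smulRight eZ) w =
      a q • (toLp 2 ![x 0, x 1, 0] : EuclideanSpace ℝ (Fin 3)) + c q • rotGen x := by
    rw [← horizontal_eq_clm, hw, horizontal_frame]
  have hDJ : rotGenL w = a q • rotGen x - c q • (toLp 2 ![x 0, x 1, 0] : EuclideanSpace ℝ (Fin 3)) := by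
    rw [rotGenL_apply, hw, rotGen_frame]
  have e : (fun y : EuclideanSpace ℝ (Fin 3) => a (meridian y) •
        (toLp 2 ![y 0, y 1, 0] : EuclideanSpace ℝ (Fin 3)) + b (meridian y) • eZ +
        c (meridian y) • rotGen y) =
      (((fun y : EuclideanSpace ℝ (Fin 3) => a (meridian y)) • fun y : EuclideanSpace ℝ (Fin 3) =>
          (toLp 2 ![y 0, y 1, 0] : EuclideanSpace ℝ (Fin 3))) +
        (fun y : EuclideanSpace ℝ (Fin 3) => b (meridian y)) • fun _ : EuclideanSpace ℝ (Fin 3) =>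
          (eZ : EuclideanSpace ℝ (Fin 3))) +
      (fun y : EuclideanSpace ℝ (Fin 3) => c (meridian y)) • rotGen := rfl
  rw [convect_apply, e, hΦ.fderiv]
  simp only [_root_.add_apply, _root_.FunLike.coe_smul, Pi.smul_apply,
    ContinuousLinearMap.smulRight_apply, smul_zero, zero_add]
  rw [← hq, ← hw, hTa, hTb, hTc, hDH, hDJ]
  ext i
  fin_cases i <;> simp [rotGen, eZ] <;> ring

/-- **The divergence of a frame field**, off the axis: `div Φ(x) = 2a + r∂ᵣa + ∂_z b`
(`div h = 2`, `div J = 0`, `Jx·∇ = ∂_φ` kills lifted profiles). [folklore] -/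
theorem divergence_frame (hx : cylRadius x ≠ 0) (ha : DifferentiableAt ℝ a (meridian x))
    (hb : DifferentiableAt ℝ b (meridian x)) (hc : DifferentiableAt ℝ c (meridian x)) :
    VectorCalculus.divergence (fun y : EuclideanSpace ℝ (Fin 3) => a (meridian y) •
        (toLp 2 ![y 0, y 1, 0] : EuclideanSpace ℝ (Fin 3)) + b (meridian y) • eZ +
        c (meridian y) • rotGen y) x =
      2 * a (meridian x) + cylRadius x * derivR a (meridian x) + derivZ b (meridian x) := by
  have hH : DifferentiableAt ℝ (fun y : EuclideanSpace ℝ (Fin 3) =>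
      (toLp 2 ![y 0, y 1, 0] : EuclideanSpace ℝ (Fin 3))) x :=
    (hasFDerivAt_horizontal x).differentiableAt
  have hJ : DifferentiableAt ℝ rotGen x := (hasFDerivAt_rotGen x).differentiableAt
  have h1 : VectorCalculus.divergence (fun y : EuclideanSpace ℝ (Fin 3) => a (meridian y) •
      (toLp 2 ![y 0, y 1, 0] : EuclideanSpace ℝ (Fin 3))) x =
      2 * a (meridian x) + cylRadius x * derivR a (meridian x) := by
    rw [divergence_comp_meridian_smul hx ha hH, divergence_horizontal,
      fderiv_comp_meridian_horizontal hx ha]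
    ring
  have h2 : VectorCalculus.divergence (fun y : EuclideanSpace ℝ (Fin 3) =>
      b (meridian y) • (eZ : EuclideanSpace ℝ (Fin 3))) x = derivZ b (meridian x) := by
    rw [divergence_comp_meridian_smul hx hb (differentiableAt_const _), fderiv_comp_meridian_eZ hx hb]
    have : VectorCalculus.divergence (fun _ : EuclideanSpace ℝ (Fin 3) => (eZ : EuclideanSpace ℝ (Fin 3))) x = 0 := by
      simp [VectorCalculus.divergence]
    rw [this, mul_zero, zero_add]
  have h3 : VectorCalculus.divergence (fun y : EuclideanSpace ℝ (Fin 3) =>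
      c (meridian y) • rotGen y) x = 0 := by
    rw [divergence_comp_meridian_smul hx hc hJ, divergence_rotGen, fderiv_comp_meridian_rotGen hx hc]
    ring
  have hd1 : DifferentiableAt ℝ (fun y : EuclideanSpace ℝ (Fin 3) => a (meridian y) •
      (toLp 2 ![y 0, y 1, 0] : EuclideanSpace ℝ (Fin 3))) x :=
    (differentiableAt_comp_meridian hx ha).smul hH
  have hd2 : DifferentiableAt ℝ (fun y : EuclideanSpace ℝ (Fin 3) =>
      b (meridian y) • (eZ : EuclideanSpace ℝ (Fin 3))) x :=
    (differentiableAt_comp_meridian hx hb).smul (differentiableAt_const _)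
  have hd3 : DifferentiableAt ℝ (fun y : EuclideanSpace ℝ (Fin 3) => c (meridian y) • rotGen y) x :=
    (differentiableAt_comp_meridian hx hc).smul hJ
  have hd12 : DifferentiableAt ℝ (fun y : EuclideanSpace ℝ (Fin 3) => a (meridian y) •
      (toLp 2 ![y 0, y 1, 0] : EuclideanSpace ℝ (Fin 3)) + b (meridian y) • (eZ : EuclideanSpace ℝ (Fin 3))) x :=
    hd1.add hd2
  rw [divergence_add_apply hd12 hd3, divergence_add_apply hd1 hd2, h1, h2, h3, add_zero]

/-- **The source field `W[Φ] = (Φ·∇)Φ + (div Φ) Φ` of a frame field**, off the axis: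
`W[Φ](x) = P hx + M Jx + Q x̂_axis` with `P = Ta + a² - c² + da`, `M = Tc + 2ac + dc`,
`Q = Tb + db`, `d = div Φ = 2a + r∂ᵣa + ∂_z b`, `Te = a r∂ᵣe + b∂_z e` (values at
`q = meridian x`). [folklore] -/
theorem sourceField_frame (hx : cylRadius x ≠ 0) (ha : DifferentiableAt ℝ a (meridian x))
    (hb : DifferentiableAt ℝ b (meridian x)) (hc : DifferentiableAt ℝ c (meridian x)) :
    convect (fun y : EuclideanSpace ℝ (Fin 3) => a (meridian y) •
        (toLp 2 ![y 0, y 1, 0] : EuclideanSpace ℝ (Fin 3)) + b (meridian y) • eZ +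
        c (meridian y) • rotGen y)
      (fun y : EuclideanSpace ℝ (Fin 3) => a (meridian y) •
        (toLp 2 ![y 0, y 1, 0] : EuclideanSpace ℝ (Fin 3)) + b (meridian y) • eZ +
        c (meridian y) • rotGen y) x +
      VectorCalculus.divergence (fun y : EuclideanSpace ℝ (Fin 3) => a (meridian y) •
        (toLp 2 ![y 0, y 1, 0] : EuclideanSpace ℝ (Fin 3)) + b (meridian y) • eZ +
        c (meridian y) • rotGen y) x •
      (a (meridian x) • (toLp 2 ![x 0, x 1, 0] : EuclideanSpace ℝ (Fin 3)) + b (meridian x) • eZ +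
        c (meridian x) • rotGen x) =
      (a (meridian x) * (cylRadius x * derivR a (meridian x)) + b (meridian x) * derivZ a (meridian x) +
          a (meridian x) ^ 2 - c (meridian x) ^ 2 +
          (2 * a (meridian x) + cylRadius x * derivR a (meridian x) + derivZ b (meridian x)) *
            a (meridian x)) •
        (toLp 2 ![x 0, x 1, 0] : EuclideanSpace ℝ (Fin 3)) +
      (a (meridian x) * (cylRadius x * derivR c (meridian x)) + b (meridian x) * derivZ c (meridian x) +
          2 * a (meridian x) * c (meridian x) +
          (2 * a (meridian x) + cylRadius x * derivR a (meridian x) + derivZ b (meridian x)) *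
            c (meridian x)) • rotGen x +
      (a (meridian x) * (cylRadius x * derivR b (meridian x)) + b (meridian x) * derivZ b (meridian x) +
          (2 * a (meridian x) + cylRadius x * derivR a (meridian x) + derivZ b (meridian x)) *
            b (meridian x)) • eZ := by
  rw [convect_frame hx ha hb hc, divergence_frame hx ha hb hc]
  ext i
  fin_cases i <;> simp [rotGen, eZ] <;> ring

end Frame

/-! ### Two swirl profiles on the same poloidal data: the difference of the sources -/

section Difference

variable {a b c₁ c₂ : ℝ × ℝ → ℝ} {r₀ : ℝ}

/-- The divergence only depends on the germ of the field. [folklore] -/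
theorem divergence_congr_nhds {v w : EuclideanSpace ℝ (Fin 3) → EuclideanSpace ℝ (Fin 3)}
    {x : EuclideanSpace ℝ (Fin 3)} (h : v =ᶠ[𝓝 x] w) :
    VectorCalculus.divergence v x = VectorCalculus.divergence w x := by
  simp only [VectorCalculus.divergence, h.fderiv_eq]

/-- A frame field with smooth profiles vanishing near the axis is smooth on `ℝ³`. [folklore] -/
theorem contDiff_frameField (ha : ContDiff ℝ ∞ a) (hb : ContDiff ℝ ∞ b) (hc : ContDiff ℝ ∞ c₁)
    (hr₀ : 0 < r₀) (h0 : ∀ q : ℝ × ℝ, q.1 < r₀ → a q = 0 ∧ b q = 0 ∧ c₁ q = 0) :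
    ContDiff ℝ ∞ fun y : EuclideanSpace ℝ (Fin 3) => a (meridian y) •
        (toLp 2 ![y 0, y 1, 0] : EuclideanSpace ℝ (Fin 3)) + b (meridian y) • eZ +
        c₁ (meridian y) • rotGen y :=
  (((contDiff_comp_meridian_of_eq_zero ha hr₀ fun q hq => (h0 q hq).1).smul
    contDiff_horizontal).add
    ((contDiff_comp_meridian_of_eq_zero hb hr₀ fun q hq => (h0 q hq).2.1).smul contDiff_const)).add
    ((contDiff_comp_meridian_of_eq_zero hc hr₀ fun q hq => (h0 q hq).2.2).smul rotGenL.contDiff)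

/-- The source field `W[Φ] = (Φ·∇)Φ + (div Φ)Φ` of a smooth field is `C¹` (indeed smooth).
[folklore] -/
theorem differentiable_sourceField {Φ : EuclideanSpace ℝ (Fin 3) → EuclideanSpace ℝ (Fin 3)}
    (hΦ : ContDiff ℝ ∞ Φ) :
    Differentiable ℝ fun y => convect Φ Φ y + VectorCalculus.divergence Φ y • Φ y := by
  have h3 : ContDiff ℝ (1 + 1 + 1) Φ := hΦ.of_le (by decide)
  have hW : ContDiff ℝ (1 + 1) fun y => convect Φ Φ y + VectorCalculus.divergence Φ y • Φ y :=
    (contDiff_convect_self h3).add ((contDiff_divergence h3).smul (h3.of_le le_self_add))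
  exact hW.differentiable (by decide)

/-- **The pressure sources of two frame fields with the same poloidal profiles `a, b` and swirl
profiles `c₁, c₂`** (smooth, vanishing near the axis) **differ by `-(2κ + r∂ᵣκ)`,
`κ = c₁² - c₂²`**: all the terms involving `a, b` cancel, the `J`-components have zero
divergence. This is the computation behind Ożański's "`F_k(y) - G_k(y) = (∂₂f² - ∂₂f_k²)/2z₂`
… as all the terms that include the components of `v_k`'s vanish" (App. A.3).
[cite: Ozanski2017NSISingular, App. A.3, first lemma (held: Lemma 23), proof] -/
theorem pressureSource_frame_sub (ha : ContDiff ℝ ∞ a) (hb : ContDiff ℝ ∞ b) (hc₁ : ContDiff ℝ ∞ c₁)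
    (hc₂ : ContDiff ℝ ∞ c₂) (hr₀ : 0 < r₀)
    (h0 : ∀ q : ℝ × ℝ, q.1 < r₀ → a q = 0 ∧ b q = 0 ∧ c₁ q = 0 ∧ c₂ q = 0)
    {x : EuclideanSpace ℝ (Fin 3)} (hx : cylRadius x ≠ 0) :
    pressureSource (fun y : EuclideanSpace ℝ (Fin 3) => a (meridian y) •
        (toLp 2 ![y 0, y 1, 0] : EuclideanSpace ℝ (Fin 3)) + b (meridian y) • eZ +
        c₁ (meridian y) • rotGen y) x -
      pressureSource (fun y : EuclideanSpace ℝ (Fin 3) => a (meridian y) •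
        (toLp 2 ![y 0, y 1, 0] : EuclideanSpace ℝ (Fin 3)) + b (meridian y) • eZ +
        c₂ (meridian y) • rotGen y) x =
      -(2 * (c₁ (meridian x) ^ 2 - c₂ (meridian x) ^ 2) +
        cylRadius x * derivR (fun q => c₁ q ^ 2 - c₂ q ^ 2) (meridian x)) := by
  -- the two fields and their source fields
  set Φ₁ := fun y : EuclideanSpace ℝ (Fin 3) => a (meridian y) •
        (toLp 2 ![y 0, y 1, 0] : EuclideanSpace ℝ (Fin 3)) + b (meridian y) • eZ +
        c₁ (meridian y) • rotGen y with hΦ₁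
  set Φ₂ := fun y : EuclideanSpace ℝ (Fin 3) => a (meridian y) •
        (toLp 2 ![y 0, y 1, 0] : EuclideanSpace ℝ (Fin 3)) + b (meridian y) • eZ +
        c₂ (meridian y) • rotGen y with hΦ₂
  have hΦ₁s : ContDiff ℝ ∞ Φ₁ := contDiff_frameField ha hb hc₁ hr₀ fun q hq =>
    ⟨(h0 q hq).1, (h0 q hq).2.1, (h0 q hq).2.2.1⟩
  have hΦ₂s : ContDiff ℝ ∞ Φ₂ := contDiff_frameField ha hb hc₂ hr₀ fun q hq =>
    ⟨(h0 q hq).1, (h0 q hq).2.1, (h0 q hq).2.2.2⟩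
  -- the planar coefficient of `J` in the difference
  set Λ : ℝ × ℝ → ℝ := fun q => a q * (q.1 * (derivR c₁ q - derivR c₂ q)) +
    b q * (derivZ c₁ q - derivZ c₂ q) + 2 * a q * (c₁ q - c₂ q) +
    (2 * a q + q.1 * derivR a q + derivZ b q) * (c₁ q - c₂ q) with hΛ
  set κ : ℝ × ℝ → ℝ := fun q => c₁ q ^ 2 - c₂ q ^ 2 with hκ
  -- smoothness of the planar data
  have hdR : ∀ {e : ℝ × ℝ → ℝ}, ContDiff ℝ ∞ e → ContDiff ℝ ∞ (derivR e) := fun he =>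
    (he.fderiv_right (m := ∞) (by simp)).clm_apply contDiff_const
  have hdZ : ∀ {e : ℝ × ℝ → ℝ}, ContDiff ℝ ∞ e → ContDiff ℝ ∞ (derivZ e) := fun he =>
    (he.fderiv_right (m := ∞) (by simp)).clm_apply contDiff_const
  have hΛs : ContDiff ℝ ∞ Λ :=
    (((ha.mul (contDiff_fst.mul ((hdR hc₁).sub (hdR hc₂)))).add
      (hb.mul ((hdZ hc₁).sub (hdZ hc₂)))).add
      ((contDiff_const.mul ha).mul (hc₁.sub hc₂))).add
      ((((contDiff_const.mul ha).add (contDiff_fst.mul (hdR ha))).add (hdZ hb)).mul (hc₁.sub hc₂))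
  have hκs : ContDiff ℝ ∞ κ := (hc₁.pow 2).sub (hc₂.pow 2)
  -- the pointwise identity `W₁ - W₂ = -κ h + Λ J` off the axis
  have hpt : ∀ y : EuclideanSpace ℝ (Fin 3), cylRadius y ≠ 0 →
      (convect Φ₁ Φ₁ y + VectorCalculus.divergence Φ₁ y • Φ₁ y) -
        (convect Φ₂ Φ₂ y + VectorCalculus.divergence Φ₂ y • Φ₂ y) =
      (-κ (meridian y)) • (toLp 2 ![y 0, y 1, 0] : EuclideanSpace ℝ (Fin 3)) +
        Λ (meridian y) • rotGen y := by
    intro y hy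
    have e1 := sourceField_frame (a := a) (b := b) (c := c₁) hy (ha.differentiable (by simp) _)
      (hb.differentiable (by simp) _) (hc₁.differentiable (by simp) _)
    have e2 := sourceField_frame (a := a) (b := b) (c := c₂) hy (ha.differentiable (by simp) _)
      (hb.differentiable (by simp) _) (hc₂.differentiable (by simp) _)
    simp only [hΦ₁, hΦ₂]
    rw [e1, e2]
    have hr : (meridian y).1 = cylRadius y := rfl
    simp only [hκ, hΛ, hr]
    ext i
    fin_cases i <;> simp [rotGen, eZ] <;> ring
  -- hence an identity of germs at `x`
  have hev : (fun y => (convect Φ₁ Φ₁ y + VectorCalculus.divergence Φ₁ y • Φ₁ y) -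
        (convect Φ₂ Φ₂ y + VectorCalculus.divergence Φ₂ y • Φ₂ y)) =ᶠ[𝓝 x]
      fun y => (-κ (meridian y)) • (toLp 2 ![y 0, y 1, 0] : EuclideanSpace ℝ (Fin 3)) +
        Λ (meridian y) • rotGen y := by
    have hopen : IsOpen {y : EuclideanSpace ℝ (Fin 3) | cylRadius y ≠ 0} :=
      isOpen_ne_fun continuous_cylRadius continuous_const
    filter_upwards [hopen.mem_nhds hx] with y hy using hpt y hy
  -- differentiate
  have hW₁ := differentiable_sourceField hΦ₁s x
  have hW₂ := differentiable_sourceField hΦ₂s x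
  rw [pressureSource_def, pressureSource_def, ← divergence_sub_apply hW₁ hW₂,
    divergence_congr_nhds hev]
  have hκd : DifferentiableAt ℝ (fun q => -κ q) (meridian x) :=
    (hκs.differentiable (by simp) _).neg
  have hΛd : DifferentiableAt ℝ Λ (meridian x) := hΛs.differentiable (by simp) _
  have hH : DifferentiableAt ℝ (fun y : EuclideanSpace ℝ (Fin 3) =>
      (toLp 2 ![y 0, y 1, 0] : EuclideanSpace ℝ (Fin 3))) x :=
    (hasFDerivAt_horizontal x).differentiableAt
  have hJ : DifferentiableAt ℝ rotGen x := (hasFDerivAt_rotGen x).differentiableAt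
  have hs1 : DifferentiableAt ℝ (fun y : EuclideanSpace ℝ (Fin 3) => (-κ (meridian y)) •
      (toLp 2 ![y 0, y 1, 0] : EuclideanSpace ℝ (Fin 3))) x :=
    (differentiableAt_comp_meridian hx hκd).smul hH
  have hs2 : DifferentiableAt ℝ (fun y : EuclideanSpace ℝ (Fin 3) => Λ (meridian y) • rotGen y) x :=
    (differentiableAt_comp_meridian hx hΛd).smul hJ
  rw [divergence_add_apply hs1 hs2,
    divergence_comp_meridian_smul (G := fun q => -κ q) hx hκd hH, divergence_horizontal,
    fderiv_comp_meridian_horizontal hx hκd,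
    divergence_comp_meridian_smul (G := Λ) hx hΛd hJ, divergence_rotGen,
    fderiv_comp_meridian_rotGen hx hΛd]
  have hneg : derivR (fun q => -κ q) (meridian x) = -derivR κ (meridian x) := by
    simp only [derivR, fderiv_fun_neg, _root_.FunLike.coe_neg, Pi.neg_apply]
  rw [hneg]
  ring

end Difference

/-! ### The sources of `u[v,f]` and `u[v,g]` for two structures with the same `v` -/

section Swirl

variable {U : Set (ℝ × ℝ)} {v : ℝ × ℝ → ℝ × ℝ} {f g φ ψ : ℝ × ℝ → ℝ}

/-- `∂ᵣ (r⁻²) = -2 r⁻³` in the meridian plane (`r ≠ 0`). [folklore] -/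
theorem derivR_inv_sq {q : ℝ × ℝ} (hq : q.1 ≠ 0) :
    derivR (fun q' : ℝ × ℝ => (q'.1 ^ 2)⁻¹) q = -2 / q.1 ^ 3 := by
  have h1 : HasFDerivAt (fun q' : ℝ × ℝ => q'.1 ^ 2)
      ((2 * q.1) • ContinuousLinearMap.fst ℝ ℝ ℝ) q := by
    have := (hasFDerivAt_fst (𝕜 := ℝ) (E := ℝ) (F := ℝ) (p := q)).pow 2
    simpa using this
  have h2 := (hasFDerivAt_inv (pow_ne_zero 2 hq)).comp q h1
  rw [derivR, show (fun q' : ℝ × ℝ => (q'.1 ^ 2)⁻¹) = (fun t : ℝ => t⁻¹) ∘ fun q' : ℝ × ℝ => q'.1 ^ 2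
    from rfl, h2.fderiv]
  simp
  field_simp

/-- The source `G[u] = div((u·∇)u + (div u)u)` vanishes off the support of `u`. [folklore] -/
private theorem pressureSource_eq_zero_of_notMem_tsupport_field
    {u : EuclideanSpace ℝ (Fin 3) → EuclideanSpace ℝ (Fin 3)} {x : EuclideanSpace ℝ (Fin 3)}
    (hx : x ∉ tsupport u) : pressureSource u x = 0 := by
  rw [pressureSource_def]
  apply divergence_eq_zero_of_notMem_tsupport
  intro hx'
  refine hx (closure_mono (fun y hy => ?_) hx')
  rw [mem_support] at hy ⊢
  contrapose! hy
  simp [convect_apply, hy]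

/-- For a structure, `f² - |v|² ≥ 0` everywhere (strict in `U`, `v = 0` off `U`). [folklore] -/
theorem IsNSIStructure.sq_sub_nonneg (h : IsNSIStructure U v f φ) (q : ℝ × ℝ) :
    0 ≤ f q ^ 2 - ((v q).1 ^ 2 + (v q).2 ^ 2) := by
  by_cases hq : q ∈ U
  · exact (sub_pos.2 (h.sq_lt q hq)).le
  · have hv : v q = 0 := image_eq_zero_of_notMem_tsupport fun h' => hq (h.tsupport_v_subset h')
    simp [hv, sq_nonneg]

/-- **The pressure sources of `u[v,f]` and `u[v,g]` differ by `-r⁻¹∂ᵣ(f² - g²)`**: for two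
structures `(v,f,φ)`, `(v,g,ψ)` on the same `U` (same planar field `v`) and every `x ∈ ℝ³`,
`G[u[v,f]](x) - G[u[v,g]](x) = -(∂ᵣ(f² - g²))(R⁻¹x)/r` (`G[u] = ∂ᵢ∂ⱼ(uᵢuⱼ) = Σ∂ᵢuⱼ∂ⱼuᵢ`, the
fields being divergence free; on the axis both sides vanish). This is Ożański's
"`F_k(y) - G_k(y) = F_k(z) - G_k(z) = (∂₂f² - ∂₂f_k²)/2z₂`, as all the terms that include the
components of `v_k`'s vanish" (App. A.3, proof of the first lemma; with his `x₂ = r`, and the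
factor printed as `1/(2z₂)` being `1/z₂`: from the table (3.27), `2∂₂u₃∂₃u₂ = -2(∂_ρs)s/ρ =
-∂_ρ(s²)/ρ`, `s² = f² - |v|²` — immaterial for the convergence argument it serves).
[cite: Ozanski2017NSISingular, App. A.3, first lemma (held: Lemma 23), proof] -/
theorem IsNSIStructure.pressureSource_swirlField_sub (hf : IsNSIStructure U v f φ)
    (hg : IsNSIStructure U v g ψ) (x : EuclideanSpace ℝ (Fin 3)) :
    pressureSource (swirlField v f) x - pressureSource (swirlField v g) x =
      -(cylRadius x)⁻¹ * derivR (fun q => f q ^ 2 - g q ^ 2) (meridian x) := by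
  obtain ⟨r₀, hr₀, hr⟩ := hf.exists_axis_margin
  have h0 : ∀ q : ℝ × ℝ, q.1 < r₀ → f q = 0 ∧ g q = 0 ∧ v q = 0 := fun q hq =>
    have hq' : q ∉ closure U := fun h' => (hr q h').not_gt hq
    ⟨hf.f_eq_zero hq', hg.f_eq_zero hq', hf.v_eq_zero hq'⟩
  by_cases hxr : cylRadius x < r₀
  · -- near the axis everything vanishes
    have hx' : meridian x ∉ closure U := fun h' => (hr _ h').not_gt hxr
    have hzero : ∀ {k : ℝ × ℝ → ℝ} {χ : ℝ × ℝ → ℝ}, IsNSIStructure U v k χ →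
        pressureSource (swirlField v k) x = 0 := fun hk =>
      pressureSource_eq_zero_of_notMem_tsupport_field fun h' =>
        hx' (mem_revolve.1 (hk.tsupport_swirlField_subset h'))
    have hσ : derivR (fun q => f q ^ 2 - g q ^ 2) (meridian x) = 0 := by
      have hopen : IsOpen {q : ℝ × ℝ | q.1 < r₀} := isOpen_lt continuous_fst continuous_const
      have hev : (fun q => f q ^ 2 - g q ^ 2) =ᶠ[𝓝 (meridian x)] fun _ => (0 : ℝ) := by
        filter_upwards [hopen.mem_nhds (show (meridian x).1 < r₀ from hxr)] with q hq
        simp [(h0 q hq).1, (h0 q hq).2.1]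
      rw [derivR, hev.fderiv_eq, fderiv_const_apply]
      rfl
    rw [hzero hf, hzero hg, hσ]
    ring
  · have hx0 : cylRadius x ≠ 0 := fun h => hxr (h ▸ hr₀)
    -- the planar profiles
    have hv1 : ContDiff ℝ ∞ fun q => (v q).1 := contDiff_fst.comp hf.v_smooth
    have hv2 : ContDiff ℝ ∞ fun q => (v q).2 := contDiff_snd.comp hf.v_smooth
    have ha : ContDiff ℝ ∞ fun q : ℝ × ℝ => (v q).1 * q.1⁻¹ :=
      contDiff_mul_inv_fst_of_eq_zero hv1 hr₀ fun q hq => by simp [(h0 q hq).2.2]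
    have hcf : ContDiff ℝ ∞ fun q : ℝ × ℝ =>
        Real.sqrt (f q ^ 2 - ((v q).1 ^ 2 + (v q).2 ^ 2)) * q.1⁻¹ :=
      contDiff_mul_inv_fst_of_eq_zero hf.contDiff_sqrt hr₀ fun q hq => by
        simp [(h0 q hq).1, (h0 q hq).2.2]
    have hcg : ContDiff ℝ ∞ fun q : ℝ × ℝ =>
        Real.sqrt (g q ^ 2 - ((v q).1 ^ 2 + (v q).2 ^ 2)) * q.1⁻¹ :=
      contDiff_mul_inv_fst_of_eq_zero hg.contDiff_sqrt hr₀ fun q hq => by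
        simp [(h0 q hq).2.1, (h0 q hq).2.2]
    have key := pressureSource_frame_sub (a := fun q : ℝ × ℝ => (v q).1 * q.1⁻¹)
      (b := fun q => (v q).2)
      (c₁ := fun q : ℝ × ℝ => Real.sqrt (f q ^ 2 - ((v q).1 ^ 2 + (v q).2 ^ 2)) * q.1⁻¹)
      (c₂ := fun q : ℝ × ℝ => Real.sqrt (g q ^ 2 - ((v q).1 ^ 2 + (v q).2 ^ 2)) * q.1⁻¹)
      ha hv2 hcf hcg hr₀ (fun q hq => by simp [(h0 q hq).1, (h0 q hq).2.1, (h0 q hq).2.2]) hx0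
    rw [swirlField_eq_linear v f, swirlField_eq_linear v g]
    rw [key]
    -- identify `κ = (f² - g²)/r²` and differentiate the product
    set q₀ := meridian x with hq₀
    have hq₀1 : q₀.1 = cylRadius x := rfl
    have hq₀0 : q₀.1 ≠ 0 := hq₀1 ▸ hx0
    have hκ : (fun q : ℝ × ℝ => (Real.sqrt (f q ^ 2 - ((v q).1 ^ 2 + (v q).2 ^ 2)) * q.1⁻¹) ^ 2 -
        (Real.sqrt (g q ^ 2 - ((v q).1 ^ 2 + (v q).2 ^ 2)) * q.1⁻¹) ^ 2) =
        fun q => (f q ^ 2 - g q ^ 2) * (q.1 ^ 2)⁻¹ := by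
      funext q
      rw [mul_pow, mul_pow, Real.sq_sqrt (hf.sq_sub_nonneg q), Real.sq_sqrt (hg.sq_sub_nonneg q)]
      ring
    have hσd : DifferentiableAt ℝ (fun q => f q ^ 2 - g q ^ 2) q₀ :=
      (((hf.f_smooth.pow 2).sub (hg.f_smooth.pow 2)).differentiable (by simp)) q₀
    have hpd : DifferentiableAt ℝ (fun q : ℝ × ℝ => (q.1 ^ 2)⁻¹) q₀ :=
      (differentiableAt_fst.pow 2).inv (pow_ne_zero 2 hq₀0)
    have hprod : derivR (fun q => (f q ^ 2 - g q ^ 2) * (q.1 ^ 2)⁻¹) q₀ =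
        derivR (fun q => f q ^ 2 - g q ^ 2) q₀ * (q₀.1 ^ 2)⁻¹ +
          (f q₀ ^ 2 - g q₀ ^ 2) * (-2 / q₀.1 ^ 3) := by
      rw [← derivR_inv_sq hq₀0]
      simp only [derivR]
      rw [fderiv_fun_mul hσd hpd]
      simp
      ring
    rw [hκ, hprod]
    simp only [mul_pow, Real.sq_sqrt (hf.sq_sub_nonneg q₀), Real.sq_sqrt (hg.sq_sub_nonneg q₀)]
    rw [← hq₀1]
    field_simp
    ring

end Swirl

end Literature.Barriers.NavierStokesRegularity

end
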